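import Summits.BirchSwinnertonDyer.BirchSwinnertonDyer.Theorems.KatoDescentPotSupersingularModThreeNonsplitCartanCertificate
import Summits.BirchSwinnertonDyer.BirchSwinnertonDyer.Theorems.KatoDescentPotSupersingularWildConjAResidueCartanRows07
import Summits.BirchSwinnertonDyer.BirchSwinnertonDyer.Theorems.KatoDescentPotSupersingularWildConjAResidueCartanRows08
import HarnessLib

/-!
# Route `KatoDescentPotSupersingular` (rung K9, sub-rung B5 = O6 wild `p = 3`, cell `bsd-potss`): the `3Nn` RESIDUE ROWS of the Conj-A crux
# `WildCoatesSujathaResidue` (item 19942; node 19189 → parent 19197) — the IMAGE EQUALITY `Im ρ̄₃ = C_ns⁺(3)` NOW IN THE KERNEL, and the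
# (A) / U₀ records re-issued with `himg` DISCHARGED (part 01: 19008bu1, 19872ba1, 112455bk1)
# (seat `bsd-potss-k9-c4` g18; `--supports stmt-BirchSwinnertonDyer-19197 --as helper`)

HONEST FRAMING. THEOREMS ONLY (no definition, no named fact, no `sorry`); PER ROW; nothing is booked; items 19942 / 19189 / 19197 stay OPEN
at class level; (A), Conjecture A and BSD are proved for NO curve.  The `3Nn` residue-row records of `…WildConjAResidueCartanRows07–12`
(this seat, p627894 … p628102) displayed the image EQUALITY `HasModPImageEqNonsplitCartanNormalizer E 3` (LMFDB) as `himg`.  This seat's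
tool `ModThreeNonsplitCartanCertificate.hasModPImageEqNonsplitCartanNormalizer_three_of_intModel` (Serre 1972 §2: `E[3]` irreducible +
`ρ̄₃` not onto ⟹ `#G ∣ 16` (tree `not_dvd_card_of_not_hasSurjectiveModNGaloisRep`); an order-`8` Frobenius (`ℓ ≡ −1 (mod 3)`, `3 ∤ a_ℓ`:
`tr = a_ℓ`, `det = ℓ`, Cayley–Hamilton) and a complex conjugation generate `16` distinct elements; adapted basis ⟹ EXACTLY the tree's
`nonsplitCartanNormalizer (−1)`, all finite checks by `decide`) certifies it per row from the SAME Frobenius witness that certified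
irreducibility (`ℓ ∈ {{5, 11}}`).  Per row below: `hasModPImageEqNonsplitCartanNormalizer_g<label>_3` (kernel) and the records
`conjA_g<label>_3_img`, `missingUpperBoundAt_g<label>_3_img` (one `μ`-input + Iwasawa growth fact `hI`) and `…_img2` (growth-fact-free, two
`μ`-inputs).  After this file a `3Nn` residue-row record displays exactly: the named facts, Cremona's `r_an = 0`, and the classical
`μ`-hypothesis on the maximal real subfield of `ℚ(E[3])` — as on the `3Ns` rows.

References: [Serre1972] §2.2–§2.6, §5.2; [Serre1981] §8.1 (238); [CoatesSujatha2005] Thm. 3.4; [Kato2004Asterisque] Thm. 14.5 (3);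
[Washington1997] §7.5, §13.1; [Cremona2006] Table 1.
-/

set_option autoImplicit false
set_option linter.dupNamespace false

noncomputable section

open scoped Classical NumberField
open Polynomial WeierstrassCurve NumberField IsDedekindDomain IsDedekindDomain.HeightOneSpectrum Rat.HeightOneSpectrum Field IntermediateField
  Literature.NumberTheory.DiophantineGeometry Literature.NumberTheory.EllipticCurves
  Literature.NumberTheory.EllipticCurves.ModularForms Literature.NumberTheory.EllipticCurves.Rank1Residual
  Literature.NumberTheory.EllipticCurves.Rank1Residual.Typed Literature.NumberTheory.Automorphic
  Literature.NumberTheory.EllipticCurves.Rank1Residual.X11RankOneCertificates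
  Literature.NumberTheory.GaloisRepresentations Literature.NumberTheory.SerreUniformity Literature.NumberTheory.IwasawaTheory
  Summit.BirchSwinnertonDyer.BirchSwinnertonDyer.Rank1Residual.IntModel
  Summit.BirchSwinnertonDyer.Rank1Residual Summit.BirchSwinnertonDyer.Rank1Residual.Additive
  Summit.BirchSwinnertonDyer.Rank1Residual.X11b Summit.BirchSwinnertonDyer.Rank1Residual.Supersingular
  Summit.BirchSwinnertonDyer.BirchSwinnertonDyer.Rank2Observatory.RootNumber
  Summit.BirchSwinnertonDyer.BirchSwinnertonDyer.Theorems
  Summit.BirchSwinnertonDyer.BirchSwinnertonDyer.Theorems.TameUpperUnitTwistRecords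

namespace Summit.BirchSwinnertonDyer.BirchSwinnertonDyer.Theorems.WildUpperUnitTwistRecords

/-! ### `19008bu1` — image `3Nn` CERTIFIED (Frobenius witness `ℓ = 5 ≡ 2 (mod 3)`, `#Ẽ(𝔽_{5}) = 4`, `a_{5} = 2 ≢ 0 (mod 3)`) -/

/-- **KERNEL IMAGE CERTIFICATE `3Nn` for `19008bu1`**: the mod-`3` image EQUALS the normaliser of a non-split Cartan subgroup
(`HasModPImageEqNonsplitCartanNormalizer E 3`) — from `E[3]` irreducible (`irr_g19008bu1_3`), `ρ̄₃` not onto (`notSurjThree_g19008bu1`, `Δ` a cube)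
and the Frobenius at `ℓ = 5` (`ℓ ≡ −1 (mod 3)`, `a_ℓ = 2 ≢ 0`: an element of order `8` on `E[3]`), by this seat's tool
`ModThreeNonsplitCartanCertificate.hasModPImageEqNonsplitCartanNormalizer_three_of_intModel` (Serre 1972 §2). Hitherto an LMFDB datum
displayed as `himg`. [cite: Serre1972, §2.2, §2.4 Prop. 15] [cite: Serre1981, §8.1 (238)] [cite: Cremona2006, Table 1 (Cremona label 19008bu1)] -/
theorem hasModPImageEqNonsplitCartanNormalizer_g19008bu1_3 : HasModPImageEqNonsplitCartanNormalizer (⟨0, 0, 0, (-999), (-12312)⟩ : WeierstrassCurve ℚ) 3 := by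
  haveI := isElliptic_g19008bu1
  haveI := isGloballyMinimal_g19008bu1
  haveI : Fact (Nat.Prime 5) := ⟨by norm_num⟩
  have hI : integralModelInt (⟨0, 0, 0, (-999), (-12312)⟩ : WeierstrassCurve ℚ) = (⟨0, 0, 0, (-999), (-12312)⟩ : WeierstrassCurve ℤ) :=
    integralModelInt_eq_of_map_eq _ (map_mk_int 0 0 0 (-999) (-12312))
  have hc : Nat.card (((((⟨0, 0, 0, (-999), (-12312)⟩ : WeierstrassCurve ℤ))).map (Int.castRingHom (ZMod 5))).toAffine.Point) = 4 := by
    have h := natCard_point_eq_countPoints 0 0 0 (-999) (-12312) 5 (by norm_num) (by decide +kernel)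
    have h' : countPoints [0, 0, 0, (-999), (-12312)] 5 = 4 := countPoints_eq_of_fast (by decide +kernel)
    exact_mod_cast h.trans h'
  exact ModThreeNonsplitCartanCertificate.hasModPImageEqNonsplitCartanNormalizer_three_of_intModel hI irr_g19008bu1_3
    notSurjThree_g19008bu1 5 (by norm_num) (by decide +kernel) hc (by decide) (by decide)

/-- **(A) AT `(19008bu1, 3)` FROM ONE CLASSICAL `μ`-HYPOTHESIS — image `3Nn` now IN THE KERNEL** (`conjA_g19008bu1_3` with `himg` discharged by
`hasModPImageEqNonsplitCartanNormalizer_g19008bu1_3`): from Coates–Sujatha Thm. 3.4 (`hCS`), Iwasawa's growth theorem (`hI`), Ferrero–Washington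
(`hFW`) — named facts — and `μ = 0` for every cyclotomic `ℤ_3`-extension of the maximal real subfield `ℚ(E[3])⁺ = ℚ(P)` (degree `8`).
CONDITIONAL; nothing booked; (A)/BSD proved for no curve. [cite: CoatesSujatha2005, Thm. 3.4 (§3)] [cite: Serre1972, §2.2, §5.2 (iv)]
[cite: Washington1997, §13.1] [cite: Cremona2006, Table 1 (Cremona label 19008bu1)] -/
theorem conjA_g19008bu1_3_img
    (hCS : CoatesSujatha2005.thm34_fineSelmerDual_moduleFinite_of_classicalMuVanishes_divisionField)
    (hI : iwasawa1959_classNumberPExp_growth) (hFW : ferreroWashington1979_classicalMuVanishes)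
    {W : WeierstrassCurve ℚ} [W.IsElliptic] (hWeq : W = (⟨0, 0, 0, (-999), (-12312)⟩ : WeierstrassCurve ℚ))
    {c : absoluteGaloisGroup ℚ} (hc : IsComplexConjugation (Rat.castHom ℝ) c)
    (hμ : ∀ κE : ZpExtension ↥(fixedField (Subgroup.zpowers (absRestrictNormalHom (W.divisionField 3) c))) 3,
      κE.IsCyclotomic → ClassicalMuVanishes κE)
    (κ : ZpExtension ℚ 3) (hκ : κ.IsCyclotomic) :
    ∃ (γ : absoluteGaloisGroup ℚ) (Df : W.FineSelmerDualData κ γ),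
      Module.Finite ℤ_[3] (RestrictScalars ℤ_[3] (IwasawaAlgebra 3) Df.X) := by
  subst hWeq
  exact CartanMuRoadRealDoors.conjA_three_of_hasModPImageEqNonsplitCartanNormalizer_of_realMu' _ hCS hI hFW
    hasModPImageEqNonsplitCartanNormalizer_g19008bu1_3 hc hμ κ hκ

/-- **RECORD — U₀ `ord₃ #Ш(E) ≤ ord₃ #Ш_an(E)` for `E = 19008bu1` FROM ONE CLASSICAL `μ`-HYPOTHESIS, image `3Nn` IN THE KERNEL**
(`missingUpperBoundAt_g19008bu1_3` with `himg` discharged): named facts `hKatoA hGZK hmod hCS hI hFW`; DISPLAYED only Cremona's `r_an = 0` (`hr`)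
and `hμ` (μ = 0 for the cyclotomic `ℤ_3`-extension of the maximal real subfield of `ℚ(E[3])`). KERNEL: elliptic, minimal, `ClassO6 E 3`,
`E[3]` irreducible, image `= C_ns⁺(3)`. Per row; nothing booked; BSD proved for no curve. [cite: Kato2004Asterisque, Thm. 14.5 (3) (p. 236)]
[cite: CoatesSujatha2005, Thm. 3.4 (§3)] [cite: Washington1997, §13.1] [cite: Cremona2006, Table 1 (Cremona label 19008bu1)] -/
theorem missingUpperBoundAt_g19008bu1_3_img
    (hKatoA : Kato2004.rankZero_padicValNat_sha_add_padicValNat_tamagawa_le_of_additive_potGood_of_irreducible_of_fineSelmerDual_fg)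
    (hGZK : rank_eq_analyticRank_of_analyticRank_le_one) (hmod : hasEntireLFunction_rat)
    (hCS : CoatesSujatha2005.thm34_fineSelmerDual_moduleFinite_of_classicalMuVanishes_divisionField)
    (hI : iwasawa1959_classNumberPExp_growth) (hFW : ferreroWashington1979_classicalMuVanishes)
    {W : WeierstrassCurve ℚ} [W.IsElliptic] [W.IsGloballyMinimal] (hWeq : W = (⟨0, 0, 0, (-999), (-12312)⟩ : WeierstrassCurve ℚ)) (hr : W.analyticRank = 0)
    {c : absoluteGaloisGroup ℚ} (hc : IsComplexConjugation (Rat.castHom ℝ) c)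
    (hμ : ∀ κE : ZpExtension ↥(fixedField (Subgroup.zpowers (absRestrictNormalHom (W.divisionField 3) c))) 3,
      κE.IsCyclotomic → ClassicalMuVanishes κE) :
    MissingUpperBoundAt W 3 := by
  subst hWeq
  exact CartanMuRoadRealDoors.missingUpperBoundAt_three_of_hasModPImageEqNonsplitCartanNormalizer_of_realMu' _ hKatoA hGZK hmod hCS
    hI hFW hr classO6_g19008bu1_3 irr_g19008bu1_3 hasModPImageEqNonsplitCartanNormalizer_g19008bu1_3 hc hμ

/-- **RECORD — U₀ for `E = 19008bu1`, GROWTH-FACT-FREE, from TWO classical `μ`-hypotheses** (`ℚ(P)` and `ℚ(x(P))` of a real `3`-torsion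
point `P`; `τ₋` any element acting as `−1` on `E[3]`), image `3Nn` IN THE KERNEL. Named facts `hKatoA hGZK hmod hCS hFW`; displayed `hr`,
`hμ`, `hμ'`. Per row; nothing booked; BSD proved for no curve. [cite: Kato2004Asterisque, Thm. 14.5 (3) (p. 236)]
[cite: CoatesSujatha2005, Thm. 3.4 (§3)] [cite: Washington1997, §7.5, §13.1] [cite: Cremona2006, Table 1 (Cremona label 19008bu1)] -/
theorem missingUpperBoundAt_g19008bu1_3_img2
    (hKatoA : Kato2004.rankZero_padicValNat_sha_add_padicValNat_tamagawa_le_of_additive_potGood_of_irreducible_of_fineSelmerDual_fg)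
    (hGZK : rank_eq_analyticRank_of_analyticRank_le_one) (hmod : hasEntireLFunction_rat)
    (hCS : CoatesSujatha2005.thm34_fineSelmerDual_moduleFinite_of_classicalMuVanishes_divisionField)
    (hFW : ferreroWashington1979_classicalMuVanishes)
    {W : WeierstrassCurve ℚ} [W.IsElliptic] [W.IsGloballyMinimal] (hWeq : W = (⟨0, 0, 0, (-999), (-12312)⟩ : WeierstrassCurve ℚ)) (hr : W.analyticRank = 0)
    {c : absoluteGaloisGroup ℚ} (hc : IsComplexConjugation (Rat.castHom ℝ) c)
    (hμ : ∀ κE : ZpExtension ↥(fixedField (Subgroup.zpowers (absRestrictNormalHom (W.divisionField 3) c))) 3,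
      κE.IsCyclotomic → ClassicalMuVanishes κE)
    (hμ' : ∀ τm : absoluteGaloisGroup ℚ, (∀ T : W.geomTorsion (3 : ℕ), τm • T = -T) →
      ∀ κE : ZpExtension ↥(fixedField (Subgroup.zpowers (absRestrictNormalHom (W.divisionField 3) c) ⊔
        Subgroup.zpowers (absRestrictNormalHom (W.divisionField 3) τm))) 3, κE.IsCyclotomic → ClassicalMuVanishes κE) :
    MissingUpperBoundAt W 3 := by
  subst hWeq
  exact CartanMuRoadRealDoors.missingUpperBoundAt_three_of_hasModPImageEqNonsplitCartanNormalizer_of_realMu _ hKatoA hGZK hmod hCS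
    hFW hr classO6_g19008bu1_3 irr_g19008bu1_3 hasModPImageEqNonsplitCartanNormalizer_g19008bu1_3 hc hμ hμ'

/-! ### `19872ba1` — image `3Nn` CERTIFIED (Frobenius witness `ℓ = 5 ≡ 2 (mod 3)`, `#Ẽ(𝔽_{5}) = 8`, `a_{5} = -2 ≢ 0 (mod 3)`) -/

/-- **KERNEL IMAGE CERTIFICATE `3Nn` for `19872ba1`**: the mod-`3` image EQUALS the normaliser of a non-split Cartan subgroup
(`HasModPImageEqNonsplitCartanNormalizer E 3`) — from `E[3]` irreducible (`irr_g19872ba1_3`), `ρ̄₃` not onto (`notSurjThree_g19872ba1`, `Δ` a cube)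
and the Frobenius at `ℓ = 5` (`ℓ ≡ −1 (mod 3)`, `a_ℓ = -2 ≢ 0`: an element of order `8` on `E[3]`), by this seat's tool
`ModThreeNonsplitCartanCertificate.hasModPImageEqNonsplitCartanNormalizer_three_of_intModel` (Serre 1972 §2). Hitherto an LMFDB datum
displayed as `himg`. [cite: Serre1972, §2.2, §2.4 Prop. 15] [cite: Serre1981, §8.1 (238)] [cite: Cremona2006, Table 1 (Cremona label 19872ba1)] -/
theorem hasModPImageEqNonsplitCartanNormalizer_g19872ba1_3 : HasModPImageEqNonsplitCartanNormalizer (⟨0, 0, 0, (-127116), (-17444160)⟩ : WeierstrassCurve ℚ) 3 := by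
  haveI := isElliptic_g19872ba1
  haveI := isGloballyMinimal_g19872ba1
  haveI : Fact (Nat.Prime 5) := ⟨by norm_num⟩
  have hI : integralModelInt (⟨0, 0, 0, (-127116), (-17444160)⟩ : WeierstrassCurve ℚ) = (⟨0, 0, 0, (-127116), (-17444160)⟩ : WeierstrassCurve ℤ) :=
    integralModelInt_eq_of_map_eq _ (map_mk_int 0 0 0 (-127116) (-17444160))
  have hc : Nat.card (((((⟨0, 0, 0, (-127116), (-17444160)⟩ : WeierstrassCurve ℤ))).map (Int.castRingHom (ZMod 5))).toAffine.Point) = 8 := by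
    have h := natCard_point_eq_countPoints 0 0 0 (-127116) (-17444160) 5 (by norm_num) (by decide +kernel)
    have h' : countPoints [0, 0, 0, (-127116), (-17444160)] 5 = 8 := countPoints_eq_of_fast (by decide +kernel)
    exact_mod_cast h.trans h'
  exact ModThreeNonsplitCartanCertificate.hasModPImageEqNonsplitCartanNormalizer_three_of_intModel hI irr_g19872ba1_3
    notSurjThree_g19872ba1 5 (by norm_num) (by decide +kernel) hc (by decide) (by decide)

/-- **(A) AT `(19872ba1, 3)` FROM ONE CLASSICAL `μ`-HYPOTHESIS — image `3Nn` now IN THE KERNEL** (`conjA_g19872ba1_3` with `himg` discharged by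
`hasModPImageEqNonsplitCartanNormalizer_g19872ba1_3`): from Coates–Sujatha Thm. 3.4 (`hCS`), Iwasawa's growth theorem (`hI`), Ferrero–Washington
(`hFW`) — named facts — and `μ = 0` for every cyclotomic `ℤ_3`-extension of the maximal real subfield `ℚ(E[3])⁺ = ℚ(P)` (degree `8`).
CONDITIONAL; nothing booked; (A)/BSD proved for no curve. [cite: CoatesSujatha2005, Thm. 3.4 (§3)] [cite: Serre1972, §2.2, §5.2 (iv)]
[cite: Washington1997, §13.1] [cite: Cremona2006, Table 1 (Cremona label 19872ba1)] -/
theorem conjA_g19872ba1_3_img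
    (hCS : CoatesSujatha2005.thm34_fineSelmerDual_moduleFinite_of_classicalMuVanishes_divisionField)
    (hI : iwasawa1959_classNumberPExp_growth) (hFW : ferreroWashington1979_classicalMuVanishes)
    {W : WeierstrassCurve ℚ} [W.IsElliptic] (hWeq : W = (⟨0, 0, 0, (-127116), (-17444160)⟩ : WeierstrassCurve ℚ))
    {c : absoluteGaloisGroup ℚ} (hc : IsComplexConjugation (Rat.castHom ℝ) c)
    (hμ : ∀ κE : ZpExtension ↥(fixedField (Subgroup.zpowers (absRestrictNormalHom (W.divisionField 3) c))) 3,
      κE.IsCyclotomic → ClassicalMuVanishes κE)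
    (κ : ZpExtension ℚ 3) (hκ : κ.IsCyclotomic) :
    ∃ (γ : absoluteGaloisGroup ℚ) (Df : W.FineSelmerDualData κ γ),
      Module.Finite ℤ_[3] (RestrictScalars ℤ_[3] (IwasawaAlgebra 3) Df.X) := by
  subst hWeq
  exact CartanMuRoadRealDoors.conjA_three_of_hasModPImageEqNonsplitCartanNormalizer_of_realMu' _ hCS hI hFW
    hasModPImageEqNonsplitCartanNormalizer_g19872ba1_3 hc hμ κ hκ

/-- **RECORD — U₀ `ord₃ #Ш(E) ≤ ord₃ #Ш_an(E)` for `E = 19872ba1` FROM ONE CLASSICAL `μ`-HYPOTHESIS, image `3Nn` IN THE KERNEL**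
(`missingUpperBoundAt_g19872ba1_3` with `himg` discharged): named facts `hKatoA hGZK hmod hCS hI hFW`; DISPLAYED only Cremona's `r_an = 0` (`hr`)
and `hμ` (μ = 0 for the cyclotomic `ℤ_3`-extension of the maximal real subfield of `ℚ(E[3])`). KERNEL: elliptic, minimal, `ClassO6 E 3`,
`E[3]` irreducible, image `= C_ns⁺(3)`. Per row; nothing booked; BSD proved for no curve. [cite: Kato2004Asterisque, Thm. 14.5 (3) (p. 236)]
[cite: CoatesSujatha2005, Thm. 3.4 (§3)] [cite: Washington1997, §13.1] [cite: Cremona2006, Table 1 (Cremona label 19872ba1)] -/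
theorem missingUpperBoundAt_g19872ba1_3_img
    (hKatoA : Kato2004.rankZero_padicValNat_sha_add_padicValNat_tamagawa_le_of_additive_potGood_of_irreducible_of_fineSelmerDual_fg)
    (hGZK : rank_eq_analyticRank_of_analyticRank_le_one) (hmod : hasEntireLFunction_rat)
    (hCS : CoatesSujatha2005.thm34_fineSelmerDual_moduleFinite_of_classicalMuVanishes_divisionField)
    (hI : iwasawa1959_classNumberPExp_growth) (hFW : ferreroWashington1979_classicalMuVanishes)
    {W : WeierstrassCurve ℚ} [W.IsElliptic] [W.IsGloballyMinimal] (hWeq : W = (⟨0, 0, 0, (-127116), (-17444160)⟩ : WeierstrassCurve ℚ)) (hr : W.analyticRank = 0)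
    {c : absoluteGaloisGroup ℚ} (hc : IsComplexConjugation (Rat.castHom ℝ) c)
    (hμ : ∀ κE : ZpExtension ↥(fixedField (Subgroup.zpowers (absRestrictNormalHom (W.divisionField 3) c))) 3,
      κE.IsCyclotomic → ClassicalMuVanishes κE) :
    MissingUpperBoundAt W 3 := by
  subst hWeq
  exact CartanMuRoadRealDoors.missingUpperBoundAt_three_of_hasModPImageEqNonsplitCartanNormalizer_of_realMu' _ hKatoA hGZK hmod hCS
    hI hFW hr classO6_g19872ba1_3 irr_g19872ba1_3 hasModPImageEqNonsplitCartanNormalizer_g19872ba1_3 hc hμ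

/-- **RECORD — U₀ for `E = 19872ba1`, GROWTH-FACT-FREE, from TWO classical `μ`-hypotheses** (`ℚ(P)` and `ℚ(x(P))` of a real `3`-torsion
point `P`; `τ₋` any element acting as `−1` on `E[3]`), image `3Nn` IN THE KERNEL. Named facts `hKatoA hGZK hmod hCS hFW`; displayed `hr`,
`hμ`, `hμ'`. Per row; nothing booked; BSD proved for no curve. [cite: Kato2004Asterisque, Thm. 14.5 (3) (p. 236)]
[cite: CoatesSujatha2005, Thm. 3.4 (§3)] [cite: Washington1997, §7.5, §13.1] [cite: Cremona2006, Table 1 (Cremona label 19872ba1)] -/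
theorem missingUpperBoundAt_g19872ba1_3_img2
    (hKatoA : Kato2004.rankZero_padicValNat_sha_add_padicValNat_tamagawa_le_of_additive_potGood_of_irreducible_of_fineSelmerDual_fg)
    (hGZK : rank_eq_analyticRank_of_analyticRank_le_one) (hmod : hasEntireLFunction_rat)
    (hCS : CoatesSujatha2005.thm34_fineSelmerDual_moduleFinite_of_classicalMuVanishes_divisionField)
    (hFW : ferreroWashington1979_classicalMuVanishes)
    {W : WeierstrassCurve ℚ} [W.IsElliptic] [W.IsGloballyMinimal] (hWeq : W = (⟨0, 0, 0, (-127116), (-17444160)⟩ : WeierstrassCurve ℚ)) (hr : W.analyticRank = 0)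
    {c : absoluteGaloisGroup ℚ} (hc : IsComplexConjugation (Rat.castHom ℝ) c)
    (hμ : ∀ κE : ZpExtension ↥(fixedField (Subgroup.zpowers (absRestrictNormalHom (W.divisionField 3) c))) 3,
      κE.IsCyclotomic → ClassicalMuVanishes κE)
    (hμ' : ∀ τm : absoluteGaloisGroup ℚ, (∀ T : W.geomTorsion (3 : ℕ), τm • T = -T) →
      ∀ κE : ZpExtension ↥(fixedField (Subgroup.zpowers (absRestrictNormalHom (W.divisionField 3) c) ⊔
        Subgroup.zpowers (absRestrictNormalHom (W.divisionField 3) τm))) 3, κE.IsCyclotomic → ClassicalMuVanishes κE) :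
    MissingUpperBoundAt W 3 := by
  subst hWeq
  exact CartanMuRoadRealDoors.missingUpperBoundAt_three_of_hasModPImageEqNonsplitCartanNormalizer_of_realMu _ hKatoA hGZK hmod hCS
    hFW hr classO6_g19872ba1_3 irr_g19872ba1_3 hasModPImageEqNonsplitCartanNormalizer_g19872ba1_3 hc hμ hμ'

/-! ### `112455bk1` — image `3Nn` CERTIFIED (Frobenius witness `ℓ = 11 ≡ 2 (mod 3)`, `#Ẽ(𝔽_{11}) = 14`, `a_{11} = -2 ≢ 0 (mod 3)`) -/

/-- **KERNEL IMAGE CERTIFICATE `3Nn` for `112455bk1`**: the mod-`3` image EQUALS the normaliser of a non-split Cartan subgroup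
(`HasModPImageEqNonsplitCartanNormalizer E 3`) — from `E[3]` irreducible (`irr_g112455bk1_3`), `ρ̄₃` not onto (`notSurjThree_g112455bk1`, `Δ` a cube)
and the Frobenius at `ℓ = 11` (`ℓ ≡ −1 (mod 3)`, `a_ℓ = -2 ≢ 0`: an element of order `8` on `E[3]`), by this seat's tool
`ModThreeNonsplitCartanCertificate.hasModPImageEqNonsplitCartanNormalizer_three_of_intModel` (Serre 1972 §2). Hitherto an LMFDB datum
displayed as `himg`. [cite: Serre1972, §2.2, §2.4 Prop. 15] [cite: Serre1981, §8.1 (238)] [cite: Cremona2006, Table 1 (Cremona label 112455bk1)] -/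
theorem hasModPImageEqNonsplitCartanNormalizer_g112455bk1_3 : HasModPImageEqNonsplitCartanNormalizer (⟨1, (-1), 0, (-12324300), 16726248125⟩ : WeierstrassCurve ℚ) 3 := by
  haveI := isElliptic_g112455bk1
  haveI := isGloballyMinimal_g112455bk1
  haveI : Fact (Nat.Prime 11) := ⟨by norm_num⟩
  have hI : integralModelInt (⟨1, (-1), 0, (-12324300), 16726248125⟩ : WeierstrassCurve ℚ) = (⟨1, (-1), 0, (-12324300), 16726248125⟩ : WeierstrassCurve ℤ) :=
    integralModelInt_eq_of_map_eq _ (map_mk_int 1 (-1) 0 (-12324300) 16726248125)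
  have hc : Nat.card (((((⟨1, (-1), 0, (-12324300), 16726248125⟩ : WeierstrassCurve ℤ))).map (Int.castRingHom (ZMod 11))).toAffine.Point) = 14 := by
    have h := natCard_point_eq_countPoints 1 (-1) 0 (-12324300) 16726248125 11 (by norm_num) (by decide +kernel)
    have h' : countPoints [1, (-1), 0, (-12324300), 16726248125] 11 = 14 := countPoints_eq_of_fast (by decide +kernel)
    exact_mod_cast h.trans h'
  exact ModThreeNonsplitCartanCertificate.hasModPImageEqNonsplitCartanNormalizer_three_of_intModel hI irr_g112455bk1_3
    notSurjThree_g112455bk1 11 (by norm_num) (by decide +kernel) hc (by decide) (by decide)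

/-- **(A) AT `(112455bk1, 3)` FROM ONE CLASSICAL `μ`-HYPOTHESIS — image `3Nn` now IN THE KERNEL** (`conjA_g112455bk1_3` with `himg` discharged by
`hasModPImageEqNonsplitCartanNormalizer_g112455bk1_3`): from Coates–Sujatha Thm. 3.4 (`hCS`), Iwasawa's growth theorem (`hI`), Ferrero–Washington
(`hFW`) — named facts — and `μ = 0` for every cyclotomic `ℤ_3`-extension of the maximal real subfield `ℚ(E[3])⁺ = ℚ(P)` (degree `8`).
CONDITIONAL; nothing booked; (A)/BSD proved for no curve. [cite: CoatesSujatha2005, Thm. 3.4 (§3)] [cite: Serre1972, §2.2, §5.2 (iv)]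
[cite: Washington1997, §13.1] [cite: Cremona2006, Table 1 (Cremona label 112455bk1)] -/
theorem conjA_g112455bk1_3_img
    (hCS : CoatesSujatha2005.thm34_fineSelmerDual_moduleFinite_of_classicalMuVanishes_divisionField)
    (hI : iwasawa1959_classNumberPExp_growth) (hFW : ferreroWashington1979_classicalMuVanishes)
    {W : WeierstrassCurve ℚ} [W.IsElliptic] (hWeq : W = (⟨1, (-1), 0, (-12324300), 16726248125⟩ : WeierstrassCurve ℚ))
    {c : absoluteGaloisGroup ℚ} (hc : IsComplexConjugation (Rat.castHom ℝ) c)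
    (hμ : ∀ κE : ZpExtension ↥(fixedField (Subgroup.zpowers (absRestrictNormalHom (W.divisionField 3) c))) 3,
      κE.IsCyclotomic → ClassicalMuVanishes κE)
    (κ : ZpExtension ℚ 3) (hκ : κ.IsCyclotomic) :
    ∃ (γ : absoluteGaloisGroup ℚ) (Df : W.FineSelmerDualData κ γ),
      Module.Finite ℤ_[3] (RestrictScalars ℤ_[3] (IwasawaAlgebra 3) Df.X) := by
  subst hWeq
  exact CartanMuRoadRealDoors.conjA_three_of_hasModPImageEqNonsplitCartanNormalizer_of_realMu' _ hCS hI hFW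
    hasModPImageEqNonsplitCartanNormalizer_g112455bk1_3 hc hμ κ hκ

/-- **RECORD — U₀ `ord₃ #Ш(E) ≤ ord₃ #Ш_an(E)` for `E = 112455bk1` FROM ONE CLASSICAL `μ`-HYPOTHESIS, image `3Nn` IN THE KERNEL**
(`missingUpperBoundAt_g112455bk1_3` with `himg` discharged): named facts `hKatoA hGZK hmod hCS hI hFW`; DISPLAYED only Cremona's `r_an = 0` (`hr`)
and `hμ` (μ = 0 for the cyclotomic `ℤ_3`-extension of the maximal real subfield of `ℚ(E[3])`). KERNEL: elliptic, minimal, `ClassO6 E 3`,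
`E[3]` irreducible, image `= C_ns⁺(3)`. Per row; nothing booked; BSD proved for no curve. [cite: Kato2004Asterisque, Thm. 14.5 (3) (p. 236)]
[cite: CoatesSujatha2005, Thm. 3.4 (§3)] [cite: Washington1997, §13.1] [cite: Cremona2006, Table 1 (Cremona label 112455bk1)] -/
theorem missingUpperBoundAt_g112455bk1_3_img
    (hKatoA : Kato2004.rankZero_padicValNat_sha_add_padicValNat_tamagawa_le_of_additive_potGood_of_irreducible_of_fineSelmerDual_fg)
    (hGZK : rank_eq_analyticRank_of_analyticRank_le_one) (hmod : hasEntireLFunction_rat)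
    (hCS : CoatesSujatha2005.thm34_fineSelmerDual_moduleFinite_of_classicalMuVanishes_divisionField)
    (hI : iwasawa1959_classNumberPExp_growth) (hFW : ferreroWashington1979_classicalMuVanishes)
    {W : WeierstrassCurve ℚ} [W.IsElliptic] [W.IsGloballyMinimal] (hWeq : W = (⟨1, (-1), 0, (-12324300), 16726248125⟩ : WeierstrassCurve ℚ)) (hr : W.analyticRank = 0)
    {c : absoluteGaloisGroup ℚ} (hc : IsComplexConjugation (Rat.castHom ℝ) c)
    (hμ : ∀ κE : ZpExtension ↥(fixedField (Subgroup.zpowers (absRestrictNormalHom (W.divisionField 3) c))) 3,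
      κE.IsCyclotomic → ClassicalMuVanishes κE) :
    MissingUpperBoundAt W 3 := by
  subst hWeq
  exact CartanMuRoadRealDoors.missingUpperBoundAt_three_of_hasModPImageEqNonsplitCartanNormalizer_of_realMu' _ hKatoA hGZK hmod hCS
    hI hFW hr classO6_g112455bk1_3 irr_g112455bk1_3 hasModPImageEqNonsplitCartanNormalizer_g112455bk1_3 hc hμ

/-- **RECORD — U₀ for `E = 112455bk1`, GROWTH-FACT-FREE, from TWO classical `μ`-hypotheses** (`ℚ(P)` and `ℚ(x(P))` of a real `3`-torsion
point `P`; `τ₋` any element acting as `−1` on `E[3]`), image `3Nn` IN THE KERNEL. Named facts `hKatoA hGZK hmod hCS hFW`; displayed `hr`,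
`hμ`, `hμ'`. Per row; nothing booked; BSD proved for no curve. [cite: Kato2004Asterisque, Thm. 14.5 (3) (p. 236)]
[cite: CoatesSujatha2005, Thm. 3.4 (§3)] [cite: Washington1997, §7.5, §13.1] [cite: Cremona2006, Table 1 (Cremona label 112455bk1)] -/
theorem missingUpperBoundAt_g112455bk1_3_img2
    (hKatoA : Kato2004.rankZero_padicValNat_sha_add_padicValNat_tamagawa_le_of_additive_potGood_of_irreducible_of_fineSelmerDual_fg)
    (hGZK : rank_eq_analyticRank_of_analyticRank_le_one) (hmod : hasEntireLFunction_rat)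
    (hCS : CoatesSujatha2005.thm34_fineSelmerDual_moduleFinite_of_classicalMuVanishes_divisionField)
    (hFW : ferreroWashington1979_classicalMuVanishes)
    {W : WeierstrassCurve ℚ} [W.IsElliptic] [W.IsGloballyMinimal] (hWeq : W = (⟨1, (-1), 0, (-12324300), 16726248125⟩ : WeierstrassCurve ℚ)) (hr : W.analyticRank = 0)
    {c : absoluteGaloisGroup ℚ} (hc : IsComplexConjugation (Rat.castHom ℝ) c)
    (hμ : ∀ κE : ZpExtension ↥(fixedField (Subgroup.zpowers (absRestrictNormalHom (W.divisionField 3) c))) 3,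
      κE.IsCyclotomic → ClassicalMuVanishes κE)
    (hμ' : ∀ τm : absoluteGaloisGroup ℚ, (∀ T : W.geomTorsion (3 : ℕ), τm • T = -T) →
      ∀ κE : ZpExtension ↥(fixedField (Subgroup.zpowers (absRestrictNormalHom (W.divisionField 3) c) ⊔
        Subgroup.zpowers (absRestrictNormalHom (W.divisionField 3) τm))) 3, κE.IsCyclotomic → ClassicalMuVanishes κE) :
    MissingUpperBoundAt W 3 := by
  subst hWeq
  exact CartanMuRoadRealDoors.missingUpperBoundAt_three_of_hasModPImageEqNonsplitCartanNormalizer_of_realMu _ hKatoA hGZK hmod hCS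
    hFW hr classO6_g112455bk1_3 irr_g112455bk1_3 hasModPImageEqNonsplitCartanNormalizer_g112455bk1_3 hc hμ hμ'

end Summit.BirchSwinnertonDyer.BirchSwinnertonDyer.Theorems.WildUpperUnitTwistRecords

end
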